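import Summits.HodgeConjecture.HodgeConjecture.Theorems.K2E3BranchBShellZeroFibres        -- ★ p862291 (this seat); brings ★ (II)-b1 `K2E3BranchBSkewUnitSign` (`apply_eq_of_valued_sub_lt_one`, `apply_neg_one_eq_one`, `apply_eq_one_of_fixed`, `forall_placesOver_of_apply`), ★ `isUnit_of_apply_ne_zero`, ★ `isUnit_two_localRing`, ★ `valued_conjLocal_apply_of_smul_eq`
import Summits.HodgeConjecture.HodgeConjecture.Theorems.K2E3BranchBSkewUnitExists       -- ★ p862345 (this seat, (W-1)): `exists_skew_unit_valued_eq_one`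
import Literature.NumberTheory.Automorphic.HeisenbergChartShearedAtNonsplitPlace        -- ★ (LH7-p04 (g13)) the 2-free SHEARED chart: `exists_conjLocal_add_self_eq_one` (the shear constant `c`, `σc + c = 1`, `|c_w| ≤ 1`, ANY residue characteristic)
import HarnessLib

/-!
# K2 ∕ E3 «EllipticInputs», unit U4 «Keys» — socket :155 (depth 0, Branch B) at EVERY non-split place unramified in `L` (dyadic included): THE 2-FREE SHEAR FRAME LETTERS
# `c` (`σc + c = 1`, `|c_w| ≤ 1`, `|(2c − 1)_w| = 1`), the skew unit `δ₀ = 2c − 1`, the integral basis `{c, δ₀}` (`|s·c + t·δ₀|_w = max(|s_w|, |t_w|)` for `σ`-fixed `s, t`), and at a DYADIC place `ε₀ = χ₁(δ₀) = 1`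

Cell hodgecm-mathlib (D-0151), FLOOR 0, Track B «K2-LIT», engine E3, crux item H413 = stmt-HodgeConjecture-24833 (route `HCCMUnconditional`, no route verbs); target BY NAME the
OPEN socket `…U4Keys.sig_K2E3KeysThmTwoContractingRamifiedCharOneDepthZeroNormTrivial` (:155).  ★ (W-2) `K2E3KeysThmTwoDepthZeroBranchBInertLeaf.exists_eta_of_reducible_of_shellLetters`
(this seat, p862384) reduced :155 at an inert place — of ANY residue characteristic — to the two shell values `H1`, `H0`; the cell's (II)-a∕(II)-b chain (Z3-c frame v1, K2E3-p03 (g9))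
pays them at `v ∤ 2` in the chart `z = y − ½·x·σx`, whose readings (`|a + y|_w = max(|a|_w, |y|_w)` for `a` σ-fixed, `y` skew) need `|2|_w = 1`.  This file types the FRAME of the
2-free twin (the UNOWNED dyadic-inert line, seeded here by the S1 hand R90-C10-p04 (g0) under the K2 chair's valve of 2026-09-04T21:53Z): in the ★ SHEARED chart `z = y′ − c·x·σx`
(★ `HeisenbergChartShearedAtNonsplitPlace`, shear constant `c` with `σc + c = 1`) the fibre offsets `−c·x·σx` lie on the line `F_v·c`, and `{c, δ₀}` with `δ₀ := 2c − 1 = c − σc`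
(skew) is an INTEGRAL basis of `R = F_v·c ⊕ F_v·δ₀` as soon as `|(2c − 1)_w| = 1` — so the (II)-b2 «Φ₁» ∕ (II)-b3 fibre algebra repeats verbatim with `1 + y ↦ c + t·δ₀`, `R⁺ ↦ ι(F_v)`.
`--supports stmt-HodgeConjecture-24833 --as helper`; THEOREMS ONLY (no `def`, no `instance`, no notation, no named-fact hypothesis, no `sorry`).  NOT THE PAYER.

* §1 **`exists_shearConstant`** — at a non-split place unramified in `L`: `∃ c : R, σc + c = 1 ∧ |c_w| ≤ 1 ∧ |(2c − 1)_w| = 1` (dyadic: ★ `exists_conjLocal_add_self_eq_one`'s `c`,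
  `|2c| < 1`; `v ∤ 2`: `c = ½(1 + δ₀)` for the skew unit of ★ (W-1)); **`conjLocal_two_mul_sub_one`** (`σ(2c − 1) = −(2c − 1)`); **`valued_two_apply_le_one`**.
* §2 **`valued_fixed_mul_add_fixed_mul_eq_max`** — THE INTEGRAL BASIS, 2-free: for `σc + c = 1`, `|c_w| ≤ 1`, `δ₀` skew with `|(δ₀)_w| = 1`, and `σ`-FIXED `s, t`:
  `|(s·c + t·δ₀)_w| = max(|s_w|, |t_w|)` (apply `σ` and add: `u + σu = s`; then `t·δ₀ = u − s·c`).
* §3 **`apply_skew_unit_eq_one_of_dyadic`** — at a DYADIC place (`|2_w| < 1`), Branch B + depth zero: `χ₁(δ₀) = 1` for every skew unit of valuation one (`δ₁ = 2c − 1 ≡ −1` and `δ₀·δ₁` is a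
  σ-fixed unit: ★ `apply_eq_of_valued_sub_lt_one`, ★ `apply_neg_one_eq_one`, ★ `apply_eq_one_of_fixed`) — so at dyadic places the sign `ε₀` of the shell values is `+1`.

HONEST LABEL: HC_CM is proved only modulo the 7 printed citations (2 remaining named inputs: hLiu418 = stmt-HodgeConjecture-24832, h413 = stmt-HodgeConjecture-24833)
until rung 0 closes; count-neutral — this file does NOT pay the socket; no printed citation is discharged.

## References
* [Rogawski1990] J. Rogawski, *Automorphic representations of unitary groups in three variables*, Ann. of Math. Stud. 123 (1990), §1.10 p. 9 (`u(x, z)`, `z + σz + xσx = 0`), §12.2 (2) p. 173.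
* [Serre1979] J.-P. Serre, *Local Fields*, GTM 67 (1979), Ch. V §2 (the trace of an unramified extension is onto).
* [Keys1984] D. Keys, *Principal series representations of special unitary groups over local fields*, Compositio Math. 51 (1984), §4, §7 Thm. (2) p. 126.
* [MoyPrasad1996] A. Moy, G. Prasad, *Jacquet functors and unrefined minimal K-types*, Comment. Math. Helv. 71 (1996), §3 (depth zero).
-/

set_option autoImplicit false
-- the mandated namespace has the single-problem summit's repeated segment (`HodgeConjecture.HodgeConjecture`)
set_option linter.dupNamespace false

noncomputable section

open NumberField IsDedekindDomain
open Literature.NumberTheory Literature.NumberTheory.Automorphic Literature.NumberTheory.Automorphic.UnitaryGroup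

namespace Summit.HodgeConjecture.HodgeConjecture.Cruxes.H413.K2E3BranchBShearFrameLetters

open Summit.HodgeConjecture.HodgeConjecture.Cruxes.H413
open Summit.HodgeConjecture.HodgeConjecture.Cruxes.H413.K2E3BranchBSkewUnitSign

variable (L : Type) [Field L] [NumberField L] [IsCMField L] (v : HeightOneSpectrum (𝓞 ↥(maximalRealSubfield L)))
  (w : PlacesOver L v) (hw : IsCMField.complexConj L • w.1 = w.1)

/-! ## §1 The shear constant with a unit skew part -/

omit [IsCMField L] in
/-- `|2_w| ≤ 1` (`2 = 1 + 1`). [cite: Serre1979, Ch. V §2] -/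
theorem valued_two_apply_le_one : Valued.v ((2 : LocalRing L v) w) ≤ 1 := by
  have h2 : (2 : LocalRing L v) w = (1 : w.1.adicCompletion L) + 1 := by
    rw [show (2 : LocalRing L v) = 1 + 1 by norm_num, Pi.add_apply, Pi.one_apply]
  rw [h2]
  exact (Valuation.map_add _ _ _).trans (by rw [map_one, max_self])

/-- `σ(2c − 1) = −(2c − 1)` when `σc + c = 1`. [cite: Rogawski1990, §1.10 p. 9] -/
theorem conjLocal_two_mul_sub_one {c : LocalRing L v} (hc : conjLocal L (IsCMField.complexConj L) v c + c = 1) :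
    conjLocal L (IsCMField.complexConj L) v (2 * c - 1) = -(2 * c - 1) := by
  rw [map_sub, map_mul, map_ofNat, map_one, eq_sub_of_add_eq hc]; ring

/-- `σ(s·c + t·δ₀) = s·(1 − c) − t·δ₀` for `σ`-fixed `s, t`, `σc + c = 1`, `δ₀` skew — bookkeeping. [cite: Rogawski1990, §1.10 p. 9] -/
theorem conjLocal_fixed_mul_add_fixed_mul {c δ₀ s t : LocalRing L v} (hc : conjLocal L (IsCMField.complexConj L) v c + c = 1)
    (hδσ : conjLocal L (IsCMField.complexConj L) v δ₀ = -δ₀) (hs : conjLocal L (IsCMField.complexConj L) v s = s) (ht : conjLocal L (IsCMField.complexConj L) v t = t) :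
    conjLocal L (IsCMField.complexConj L) v (s * c + t * δ₀) = s * (1 - c) - t * δ₀ := by
  rw [map_add, map_mul, map_mul, hs, ht, hδσ, eq_sub_of_add_eq hc]; ring

include hw in
/-- **THE SHEAR CONSTANT WITH A UNIT SKEW PART.**  At a non-split place `v` unramified in `L` (any residue characteristic): `∃ c ∈ R`, `σc + c = 1`, `|c_w| ≤ 1`, `|(2c − 1)_w| = 1`.
DYADIC `v` (`|2_w| < 1`): the ★ shear constant (`exists_conjLocal_add_self_eq_one`) has `|2c|_w < 1`, so `|2c − 1|_w = 1`.  `v ∤ 2` (`|2_w| = 1`): `c := ½(1 + δ₀)` for the valuation-one skew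
unit `δ₀` of ★ (W-1) has `σc + c = ½(1 − δ₀) + ½(1 + δ₀) = 1`, `|c_w| ≤ 1`, `2c − 1 = δ₀`. [cite: Serre1979, Ch. V §2] [cite: Rogawski1990, §1.10 p. 9] -/
theorem exists_shearConstant (hunr : Algebra.IsUnramifiedIn (𝓞 L) v.asIdeal) :
    ∃ c : LocalRing L v, conjLocal L (IsCMField.complexConj L) v c + c = 1 ∧ Valued.v (c w) ≤ 1 ∧ Valued.v ((2 * c - 1) w) = 1 := by
  rcases (valued_two_apply_le_one L v w).lt_or_eq with h2 | h2
  · -- dyadic: the ★ shear constant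
    obtain ⟨c, hc, hcv⟩ := exists_conjLocal_add_self_eq_one L v w hw hunr
    refine ⟨c, hc, hcv, ?_⟩
    have hlt : Valued.v ((2 * c) w) < Valued.v ((-1 : LocalRing L v) w) := by
      rw [Pi.mul_apply, map_mul, Pi.neg_apply, Pi.one_apply, Valuation.map_neg, map_one]
      calc Valued.v ((2 : LocalRing L v) w) * Valued.v (c w) ≤ Valued.v ((2 : LocalRing L v) w) * 1 := mul_le_mul' le_rfl hcv
        _ < 1 := by rw [mul_one]; exact h2
    rw [show (2 * c - 1 : LocalRing L v) = -1 + 2 * c by ring, Pi.add_apply, Valuation.map_add_eq_of_lt_left _ hlt, Pi.neg_apply, Pi.one_apply,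
      Valuation.map_neg, map_one]
  · -- `v ∤ 2`: `c = ½ (1 + δ₀)`
    obtain ⟨δ₀, hδσ, hδv⟩ := K2E3BranchBSkewUnitExists.exists_skew_unit_valued_eq_one L v w hunr
    set e : (LocalRing L v)ˣ := (isUnit_two_localRing L v).unit with hedef
    have he : (e : LocalRing L v) = 2 := (isUnit_two_localRing L v).unit_spec
    have heinv : ((e⁻¹ : (LocalRing L v)ˣ) : LocalRing L v) * 2 = 1 := by rw [← he, Units.inv_mul]
    have hσeinv : conjLocal L (IsCMField.complexConj L) v ((e⁻¹ : (LocalRing L v)ˣ) : LocalRing L v) = ((e⁻¹ : (LocalRing L v)ˣ) : LocalRing L v) := by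
      have h1 : conjLocal L (IsCMField.complexConj L) v ((e⁻¹ : (LocalRing L v)ˣ) : LocalRing L v) * (e : LocalRing L v) = 1 := by
        rw [he, ← map_ofNat (conjLocal L (IsCMField.complexConj L) v) 2, ← map_mul, heinv, map_one]
      exact (Units.inv_eq_of_mul_eq_one_left h1).symm
    have heinvv : Valued.v (((e⁻¹ : (LocalRing L v)ˣ) : LocalRing L v) w) = 1 := by
      have h1 := congrArg (fun x : LocalRing L v => Valued.v (x w)) heinv
      simp only [Pi.mul_apply, map_mul, Pi.one_apply, map_one] at h1
      rw [h2, mul_one] at h1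
      exact h1
    refine ⟨((e⁻¹ : (LocalRing L v)ˣ) : LocalRing L v) * (1 + δ₀), ?_, ?_, ?_⟩
    · rw [map_mul, hσeinv, map_add, map_one, hδσ, ← mul_add, show (1 + -(δ₀ : LocalRing L v)) + (1 + δ₀) = 2 by ring, heinv]
    · rw [Pi.mul_apply, map_mul, heinvv, one_mul, Pi.add_apply]
      refine (Valuation.map_add _ _ _).trans (max_le ?_ (le_of_eq hδv))
      rw [Pi.one_apply, map_one]
    · rw [← mul_assoc, show (2 : LocalRing L v) * ((e⁻¹ : (LocalRing L v)ˣ) : LocalRing L v) = ((e⁻¹ : (LocalRing L v)ˣ) : LocalRing L v) * 2 by ring, heinv, one_mul,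
        add_sub_cancel_left]
      exact hδv

include hw in
/-- **THE SHEAR CONSTANT AND ITS SKEW UNIT**: `∃ c, ∃ δ₀ ∈ Rˣ` with `σc + c = 1`, `|c_w| ≤ 1`, `δ₀ = 2c − 1`, `σδ₀ = −δ₀`, `|(δ₀)_w| = 1` — the letters of the 2-free frame.
[cite: Rogawski1990, §1.10 p. 9] [cite: Serre1979, Ch. V §2] -/
theorem exists_shearConstant_skew_unit (hunr : Algebra.IsUnramifiedIn (𝓞 L) v.asIdeal) :
    ∃ (c : LocalRing L v) (δ₀ : (LocalRing L v)ˣ), conjLocal L (IsCMField.complexConj L) v c + c = 1 ∧ Valued.v (c w) ≤ 1 ∧ (δ₀ : LocalRing L v) = 2 * c - 1 ∧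
      conjLocal L (IsCMField.complexConj L) v (δ₀ : LocalRing L v) = -(δ₀ : LocalRing L v) ∧ Valued.v ((δ₀ : LocalRing L v) w) = 1 := by
  obtain ⟨c, hc, hcv, hδv⟩ := exists_shearConstant L v w hw hunr
  have hU : IsUnit (2 * c - 1) :=
    K2E3DepthZeroIwahoriCharacterCM.isUnit_of_apply_ne_zero L v w hw _ (fun h0 => by rw [h0, map_zero] at hδv; exact zero_ne_one hδv)
  refine ⟨c, hU.unit, hc, hcv, hU.unit_spec, ?_, ?_⟩
  · rw [hU.unit_spec]; exact conjLocal_two_mul_sub_one L v hc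
  · rw [hU.unit_spec]; exact hδv

/-! ## §2 The integral basis `{c, δ₀}`: `|s·c + t·δ₀|_w = max(|s_w|, |t_w|)` for `σ`-fixed `s, t` (2-free) -/

include hw in
/-- **THE INTEGRAL BASIS `{c, δ₀}` (2-free).**  `σc + c = 1`, `|c_w| ≤ 1`; `δ₀` skew with `|(δ₀)_w| = 1`; `s, t` `σ`-FIXED.  Then `|(s·c + t·δ₀)_w| = max(|s_w|, |t_w|)`: with `u = s·c + t·δ₀`,
`u + σu = s` gives `|s_w| ≤ |u_w|` (`σ` is an isometry at the non-split `w`, ★ `valued_conjLocal_apply_of_smul_eq`), and `t·δ₀ = u − s·c` gives `|t_w| ≤ |u_w|`; the other inequality is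
the ultrametric one.  At `v ∤ 2`, `c = ½(1 + δ₀)`, this is the reading `|a + y|_w = max(|a|_w, |y|_w)` of the Z3-c frame; the point is that it holds at `v ∣ 2`.
[cite: Rogawski1990, §1.10 p. 9] [cite: Serre1979, Ch. V §2] -/
theorem valued_fixed_mul_add_fixed_mul_eq_max {c δ₀ s t : LocalRing L v} (hc : conjLocal L (IsCMField.complexConj L) v c + c = 1) (hcv : Valued.v (c w) ≤ 1)
    (hδσ : conjLocal L (IsCMField.complexConj L) v δ₀ = -δ₀) (hδv : Valued.v (δ₀ w) = 1)
    (hs : conjLocal L (IsCMField.complexConj L) v s = s) (ht : conjLocal L (IsCMField.complexConj L) v t = t) :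
    Valued.v ((s * c + t * δ₀) w) = max (Valued.v (s w)) (Valued.v (t w)) := by
  apply le_antisymm
  · rw [Pi.add_apply]
    refine (Valuation.map_add _ _ _).trans (max_le_max ?_ ?_)
    · rw [Pi.mul_apply, map_mul]
      calc Valued.v (s w) * Valued.v (c w) ≤ Valued.v (s w) * 1 := mul_le_mul' le_rfl hcv
        _ = Valued.v (s w) := mul_one _
    · rw [Pi.mul_apply, map_mul, hδv, mul_one]
  · -- `|s_w| ≤ |u_w|` and `|t_w| ≤ |u_w|`
    have hsum : s = (s * c + t * δ₀) + conjLocal L (IsCMField.complexConj L) v (s * c + t * δ₀) := by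
      rw [conjLocal_fixed_mul_add_fixed_mul L v hc hδσ hs ht]; ring
    have hsle : Valued.v (s w) ≤ Valued.v ((s * c + t * δ₀) w) := by
      conv_lhs => rw [hsum]
      rw [Pi.add_apply]
      refine (Valuation.map_add _ _ _).trans (max_le le_rfl ?_)
      rw [valued_conjLocal_apply_of_smul_eq L v w hw]
    have htle : Valued.v (t w) ≤ Valued.v ((s * c + t * δ₀) w) := by
      have h1 : Valued.v (t w) = Valued.v (((s * c + t * δ₀) - s * c) w) := by
        rw [show (s * c + t * δ₀) - s * c = t * δ₀ by ring, Pi.mul_apply, map_mul, hδv, mul_one]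
      rw [h1, Pi.sub_apply]
      refine (Valuation.map_sub _ _ _).trans (max_le le_rfl ?_)
      rw [Pi.mul_apply, map_mul]
      calc Valued.v (s w) * Valued.v (c w) ≤ Valued.v ((s * c + t * δ₀) w) * 1 := mul_le_mul' hsle hcv
        _ = Valued.v ((s * c + t * δ₀) w) := mul_one _
    exact max_le hsle htle

/-! ## §3 At a dyadic place the sign `ε₀` is `+1` -/

include hw in
/-- **AT A DYADIC PLACE, `χ₁(δ₀) = 1` FOR EVERY SKEW UNIT OF VALUATION ONE** (Branch B, depth zero; `v` non-split, unramified in `L`, `|2_w| < 1`).  With the shear constant `c` and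
`δ₁ := 2c − 1` (skew, `|(δ₁)_w| = 1`): `|(δ₁ − (−1))_w| = |2c|_w < 1`, so `χ₁(δ₁) = χ₁(−1) = 1` (★ depth-zero congruence, ★ `apply_neg_one_eq_one`); and `δ₀·δ₁` is a `σ`-FIXED unit of valuation
one, so `χ₁(δ₀·δ₁) = 1` (★ `apply_eq_one_of_fixed`).  Hence `χ₁(δ₀) = 1`: at dyadic places the sign `ε₀` of the shell values ((II)-a, (II)-b3; ★ (W-2) `H1`, `H0`) is `+1`.
[cite: Keys1984, §7 Theorem (2) p. 126] [cite: MoyPrasad1996, §3] [cite: Rogawski1990, §12.2 (2) p. 173] -/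
theorem apply_skew_unit_eq_one_of_dyadic (hunr : Algebra.IsUnramifiedIn (𝓞 L) v.asIdeal) (h2 : Valued.v ((2 : LocalRing L v) w) < 1)
    (χ₁ : (LocalRing L v)ˣ →* ℂˣ)
    (hdepth : ∀ u : (LocalRing L v)ˣ, (∀ w' : PlacesOver L v, Valued.v (((u : LocalRing L v) w') - 1) < 1) → χ₁ u = 1)
    (hB : ∀ u : (LocalRing L v)ˣ, (∀ w' : PlacesOver L v, Valued.v ((u : LocalRing L v) w') = 1) →
      χ₁ (u * Units.map (conjLocal L (IsCMField.complexConj L) v : LocalRing L v →* LocalRing L v) u) = 1)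
    (δ₀ : (LocalRing L v)ˣ) (hδσ : conjLocal L (IsCMField.complexConj L) v (δ₀ : LocalRing L v) = -(δ₀ : LocalRing L v))
    (hδv : Valued.v ((δ₀ : LocalRing L v) w) = 1) :
    χ₁ δ₀ = 1 := by
  obtain ⟨c, δ₁, hc, hcv, hδ₁, hδ₁σ, hδ₁v⟩ := exists_shearConstant_skew_unit L v w hw hunr
  -- `χ₁ δ₁ = χ₁ (−1) = 1`
  have h1 : χ₁ δ₁ = 1 := by
    have hlt : Valued.v ((((δ₁ : LocalRing L v)) - ((-1 : (LocalRing L v)ˣ) : LocalRing L v)) w) < 1 := by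
      rw [hδ₁, Units.val_neg, Units.val_one, sub_neg_eq_add, sub_add_cancel, Pi.mul_apply, map_mul]
      calc Valued.v ((2 : LocalRing L v) w) * Valued.v (c w) ≤ Valued.v ((2 : LocalRing L v) w) * 1 := mul_le_mul' le_rfl hcv
        _ < 1 := by rw [mul_one]; exact h2
    rw [apply_eq_of_valued_sub_lt_one L v w hw χ₁ hdepth δ₁ (-1) hδ₁v hlt]
    exact apply_neg_one_eq_one L v w hw hunr χ₁ hB
  -- `δ₀ · δ₁` is a `σ`-fixed unit of valuation one
  have h2' : χ₁ (δ₀ * δ₁) = 1 := by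
    refine apply_eq_one_of_fixed L v w hw hunr χ₁ hB (δ₀ * δ₁) ?_ ?_
    · rw [Units.val_mul, Pi.mul_apply, map_mul, hδv, hδ₁v, mul_one]
    · rw [Units.val_mul, map_mul, hδσ, hδ₁σ, neg_mul_neg]
  rw [map_mul, h1, mul_one] at h2'
  exact h2'

end Summit.HodgeConjecture.HodgeConjecture.Cruxes.H413.K2E3BranchBShearFrameLetters

end
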